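import Literature.Geometry.Riemannian.RoundSphereReifenberg
import HarnessLib

/-!
# Cheeger–Colding sphere stability (Thm A.1.12 at `Sⁿ`): the reduction to the intrinsic
  Reifenberg theorem A.1.3 and Colding's "weakly regular ⟹ Reifenberg" theorem A.1.5 (iii)

The printed proof of `CheegerColding1997_sphereStability` (Cheeger–Colding, J. Differential
Geom. 46 (1997), App. 1, Thm. A.1.12, p. 459) is the sentence "By combining Theorems A.1.1 and
A.1.5" (p. 458): the INTRINSIC REIFENBERG THEOREM (Thms. A.1.2/A.1.3, p. 457, proof pp. 459–468:
two `(ε, r)`-Reifenberg-flat smooth `n`-manifolds at Gromov–Hausdorff distance `< ε(n) r` are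
diffeomorphic) and COLDING'S THEOREM A.1.5 (= [26], Colding, Ann. of Math. 145 (1997)), whose
part (iii) says that below a `δ(n, ε) r₁`-weakly-regular scale `r₁ ≤ r(n, ε)` every point of a
manifold with `Ric ≥ -(n-1)` is `(ε, s)`-Reifenberg for all `s ≤ (1-ε) r₁ - d(q, p)`.

This file PROVES that assembly (`CheegerColding1997_sphereStability_of_reifenberg_of_weaklyRegular`):
the two theorems, stated in the tree's vocabulary as the hypotheses `hA13` (A.1.3 with `Z₂ = Sⁿ`,
the round sphere being Reifenberg flat by `roundSphere_reifenbergFlat`) and `hA15`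
(A.1.5 (iii)), imply `CheegerColding1997_sphereStability`. The Gromov–Hausdorff closeness
(4.6), `d_GH(B_s(p), B_s(0)) < δ s` with `B_s(0) ⊂ ℝⁿ`, is rendered — as `IsRoundSphereGHApprox`
renders `d_GH(M, Sⁿ) < ε` — by a `δ s`-Gromov–Hausdorff approximation FROM the Euclidean ball:
`IsEuclideanBallGHChart h p s δ ψ` (`ψ : ℝⁿ → M` maps `B_s(0)` into `B_{(1+δ)s}(p)`, distorts
the length distance `d_h` by at most `δ s` on `B_s(0)`, and `ψ(B_s(0))` is `δ s`-dense in
`B_s(p)`); up to the constants absorbed by the quantifiers `∀ ε ∃ δ` this is the printed notion.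

The glue (all constants depending on `n` only): from the global `η`-approximation `f : M → Sⁿ`
and the exponential chart of the round sphere at `f p` (an `s³`-almost isometry of `s`-balls,
`exists_euclidean_almostIsometry_ball_roundSphere`) every `p ∈ M` is `δ σ`-weakly regular at one
fixed scale `σ = σ(n)` once `η ≤ δ σ / 8`
(`exists_isEuclideanBallGHChart_of_isRoundSphereGHApprox`); A.1.5 (iii) at `q = p` upgrades this
to `(ε, s)`-Reifenberg flatness of every point at all scales `s ≤ (1 - ε) σ/2`; A.1.3 with
`r = min(r₀, (1-ε) σ/2)` and `η ≤ ε₁ r` gives the diffeomorphism.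

No named facts are introduced (D-0026): A.1.3 and A.1.5 (iii) enter as HYPOTHESES of the proved
reduction theorem; the two definitions (`riemannianDistOf`, `IsEuclideanBallGHChart`) are notions
with bodies.

## References

* J. Cheeger, T. H. Colding, *On the structure of spaces with Ricci curvature bounded below. I*,
  J. Differential Geom. 46 (1997) 406–480: (4.6) p. 431; App. 1, Thms. A.1.2, A.1.3 (p. 457),
  A.1.5 (p. 458), A.1.12 (p. 459), "By combining Theorems A.1.1 and A.1.5" (p. 458).
  [CheegerColding1997]
* T. H. Colding, *Ricci curvature and volume convergence*, Ann. of Math. 145 (1997) 477–501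
  (= Thm. A.1.5). [Colding1997]
-/

noncomputable section

open Set Metric Real InnerProductGeometry Manifold Bundle Module
open scoped Manifold ContDiff ENNReal RealInnerProductSpace

namespace Literature.Geometry.Riemannian

/-! ### §1. The real-valued length distance of a `C^∞` Riemannian metric -/

section Dist

variable {n : ℕ} {M : Type} [TopologicalSpace M] [ChartedSpace (EuclideanSpace ℝ (Fin n)) M]
  [IsManifold (𝓡 n) ∞ M]

/-- The length distance `d_h(x, y) = riemannianEDist` of the `C^∞` Riemannian metric `h` (Mathlib's
infimum of lengths of `C¹` paths), as a real number — the distance entering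
`IsRoundSphereGHApprox`. [folklore] -/
def riemannianDistOf
    (h : ContMDiffRiemannianMetric (𝓡 n) ∞ (EuclideanSpace ℝ (Fin n)) (TangentSpace (𝓡 n) : M → Type _))
    (x y : M) : ℝ :=
  letI : RiemannianBundle (fun x : M ↦ TangentSpace (𝓡 n) x) :=
    ⟨h.toContinuousRiemannianMetric.toRiemannianMetric⟩
  (riemannianEDist (𝓡 n) x y).toReal

variable (h : ContMDiffRiemannianMetric (𝓡 n) ∞ (EuclideanSpace ℝ (Fin n))
  (TangentSpace (𝓡 n) : M → Type _))

/-- `0 ≤ d_h`. [folklore] -/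
theorem riemannianDistOf_nonneg (x y : M) : 0 ≤ riemannianDistOf h x y := ENNReal.toReal_nonneg

/-- `d_h(x, x) = 0`. [folklore] -/
theorem riemannianDistOf_self (x : M) : riemannianDistOf h x x = 0 := by
  simp [riemannianDistOf, riemannianEDist_self]

/-- Symmetry of `d_h`. [folklore] -/
theorem riemannianDistOf_comm (x y : M) : riemannianDistOf h x y = riemannianDistOf h y x := by
  letI : RiemannianBundle (fun x : M ↦ TangentSpace (𝓡 n) x) :=
    ⟨h.toContinuousRiemannianMetric.toRiemannianMetric⟩
  unfold riemannianDistOf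
  rw [riemannianEDist_comm]

/-- The triangle inequality for `d_h` in real form (on a connected manifold `d_h < ∞`,
`riemannianEDist_ne_top`). [folklore] -/
theorem riemannianDistOf_triangle [ConnectedSpace M] (x y z : M) :
    riemannianDistOf h x z ≤ riemannianDistOf h x y + riemannianDistOf h y z := by
  letI : RiemannianBundle (fun x : M ↦ TangentSpace (𝓡 n) x) :=
    ⟨h.toContinuousRiemannianMetric.toRiemannianMetric⟩
  unfold riemannianDistOf
  rw [← ENNReal.toReal_add (riemannianEDist_ne_top (𝓡 n) x y) (riemannianEDist_ne_top (𝓡 n) y z)]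
  exact ENNReal.toReal_mono (ENNReal.add_ne_top.2
    ⟨riemannianEDist_ne_top (𝓡 n) x y, riemannianEDist_ne_top (𝓡 n) y z⟩) riemannianEDist_triangle

/-- The distortion inequality of an `ε`-approximation to the round sphere, in terms of
`riemannianDistOf`. [cite: Colding1997Aspects, Def. 2.1] -/
theorem IsRoundSphereGHApprox.abs_angle_sub_riemannianDistOf_le {ε : ℝ}
    {f : M → Metric.sphere (0 : EuclideanSpace ℝ (Fin (n + 1))) 1} (hf : IsRoundSphereGHApprox n h ε f)
    (a b : M) :
    |angle (f a : EuclideanSpace ℝ (Fin (n + 1))) (f b) - riemannianDistOf h a b| ≤ ε :=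
  hf.1 a b

end Dist

/-! ### §2. Gromov–Hausdorff charts of balls from `ℝⁿ` (the rendering of (4.6)) -/

section Chart

variable {n : ℕ} {M : Type} [TopologicalSpace M] [ChartedSpace (EuclideanSpace ℝ (Fin n)) M]
  [IsManifold (𝓡 n) ∞ M]

/-- **`δ s`-Gromov–Hausdorff chart of the ball `B_s(p)` from the Euclidean ball `B_s(0) ⊂ ℝⁿ`**
(the rendering of Cheeger–Colding's (4.6), `d_GH(B_s(p), B_s(0)) < δ s`, through an
approximation, as in Colding 1997, *Aspects*, Def. 2.1): `ψ : ℝⁿ → M` maps `B_s(0)` into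
`B_{(1+δ)s}(p)`, distorts `d_h` by at most `δ s` on `B_s(0)`, and `ψ(B_s(0))` is `δ s`-dense in
`B_s(p)`. A point `p` with such a chart for some `s > r` is `δ`-weakly regular at scale `r`
(`p ∈ (WRⁿ)_{δ r}`), and `(ε, r)`-Reifenberg (`p ∈ (Rⁿ)_{ε r}`) when it has one for every
`s ≤ r`. [cite: CheegerColding1997, (4.6) p. 431 and App. 1 p. 457] -/
def IsEuclideanBallGHChart
    (h : ContMDiffRiemannianMetric (𝓡 n) ∞ (EuclideanSpace ℝ (Fin n)) (TangentSpace (𝓡 n) : M → Type _))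
    (p : M) (s δ : ℝ) (ψ : EuclideanSpace ℝ (Fin n) → M) : Prop :=
  (∀ v : EuclideanSpace ℝ (Fin n), ‖v‖ < s → riemannianDistOf h p (ψ v) < (1 + δ) * s) ∧
  (∀ v w : EuclideanSpace ℝ (Fin n), ‖v‖ < s → ‖w‖ < s →
    |riemannianDistOf h (ψ v) (ψ w) - ‖v - w‖| ≤ δ * s) ∧
  (∀ a : M, riemannianDistOf h p a < s →
    ∃ v : EuclideanSpace ℝ (Fin n), ‖v‖ < s ∧ riemannianDistOf h (ψ v) a ≤ δ * s)

variable {h : ContMDiffRiemannianMetric (𝓡 n) ∞ (EuclideanSpace ℝ (Fin n))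
  (TangentSpace (𝓡 n) : M → Type _)}

/-- Monotonicity of GH charts in the error parameter. [folklore] -/
theorem IsEuclideanBallGHChart.mono {p : M} {s δ δ' : ℝ} {ψ : EuclideanSpace ℝ (Fin n) → M}
    (hψ : IsEuclideanBallGHChart h p s δ ψ) (hs : 0 ≤ s) (hδ : δ ≤ δ') :
    IsEuclideanBallGHChart h p s δ' ψ := by
  obtain ⟨h1, h2, h3⟩ := hψ
  have hmul : δ * s ≤ δ' * s := mul_le_mul_of_nonneg_right hδ hs
  refine ⟨fun v hv ↦ (h1 v hv).trans_le (by nlinarith), fun v w hv hw ↦ (h2 v w hv hw).trans hmul,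
    fun a ha ↦ ?_⟩
  obtain ⟨v, hv, hva⟩ := h3 a ha
  exact ⟨v, hv, hva.trans hmul⟩

/-- **Global GH-closeness to `Sⁿ` makes every point weakly regular at a fixed scale.** Let
`f : M → Sⁿ` be an `η`-approximation (`IsRoundSphereGHApprox`), `n ≥ 1`, `0 < σ ≤ 1/2`, `δ ≤ 1`,
`16 σ ≤ δ` and `0 ≤ η ≤ δ σ / 8`. Then every `p ∈ M` has a `δ σ`-GH chart `ψ : ℝⁿ → M` of `B_σ(p)`:
`ψ v` is an `f`-preimage (up to `η`) of `exp_{f p}(L v)`, the exponential chart of the round sphere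
at `f p` being an `s³`-almost isometry of `s`-balls onto `s`-balls
(`exists_euclidean_almostIsometry_ball_roundSphere`).
[cite: CheegerColding1997, App. 1, proof of Thm. A.1.12 via Thms. A.1.3 and A.1.5] -/
theorem exists_isEuclideanBallGHChart_of_isRoundSphereGHApprox [ConnectedSpace M] (hn : 1 ≤ n)
    {η : ℝ} {f : M → Metric.sphere (0 : EuclideanSpace ℝ (Fin (n + 1))) 1}
    (hf : IsRoundSphereGHApprox n h η f) {σ δ : ℝ} (hσ0 : 0 < σ) (hσ1 : σ ≤ 1 / 2) (hδ1 : δ ≤ 1)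
    (hσδ : 16 * σ ≤ δ) (hη : η ≤ δ * σ / 8) (p : M) :
    ∃ ψ : EuclideanSpace ℝ (Fin n) → M, IsEuclideanBallGHChart h p σ δ ψ := by
  haveI : Fact (finrank ℝ (EuclideanSpace ℝ (Fin (n + 1))) = n + 1) := ⟨finrank_euclideanSpace_fin⟩
  have hη0 : 0 ≤ η := hf.nonneg
  have hδ0 : 0 < δ := by linarith
  have hησ : η ≤ σ / 8 := by nlinarith
  -- the exponential chart of the round sphere at `y = f p`, at scale `σ + η ≤ 1`
  set y := f p with hy
  have hs0 : 0 < σ + η := by linarith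
  have hs1 : σ + η ≤ 1 := by linarith
  obtain ⟨Φ, hrad, honto, hdist⟩ := exists_euclidean_almostIsometry_ball_roundSphere hn y hs0 hs1
  -- approximate `f`-preimages
  choose ψ hψ using fun v : EuclideanSpace ℝ (Fin n) ↦ hf.2 (Φ v)
  -- notation and the basic inequalities
  set D : M → M → ℝ := riemannianDistOf h with hD
  have hfD : ∀ a b : M, |angle (f a : EuclideanSpace ℝ (Fin (n + 1))) (f b) - D a b| ≤ η :=
    fun a b ↦ hf.abs_angle_sub_riemannianDistOf_le h a b
  have hψ' : ∀ v, angle (Φ v : EuclideanSpace ℝ (Fin (n + 1))) (f (ψ v)) ≤ η := fun v ↦ by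
    rw [angle_comm]; exact hψ v
  have hA4 : ∀ x x' z z' : EuclideanSpace ℝ (Fin (n + 1)),
      |angle x z - angle x' z'| ≤ angle x x' + angle z z' := by
    intro x x' z z'
    have h1 := angle_le_angle_add_angle x x' z
    have h2 := angle_le_angle_add_angle x' z' z
    have h3 := angle_le_angle_add_angle x' x z'
    have h4 := angle_le_angle_add_angle x z z'
    rw [angle_comm z' z] at h2
    rw [angle_comm x' x] at h3
    rw [abs_le]; constructor <;> linarith
  have hcube : (σ + η) ^ 2 * (σ + η) ≤ δ * σ / 4 := by
    have h1 : σ + η ≤ 2 * σ := by linarith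
    have h2 : (σ + η) ^ 2 * (σ + η) ≤ (2 * σ) ^ 2 * (2 * σ) := by
      have := pow_le_pow_left₀ hs0.le h1 3
      nlinarith [this]
    have h3 : σ * σ ≤ δ / 16 * σ := by nlinarith
    nlinarith
  refine ⟨ψ, fun v hv ↦ ?_, fun v w hv hw ↦ ?_, fun a ha ↦ ?_⟩
  · -- into `B_{(1+δ)σ}(p)`
    have hvπ : ‖v‖ ≤ π := by linarith [Real.two_le_pi, norm_nonneg v]
    have h1 : D p (ψ v) ≤ angle (f p : EuclideanSpace ℝ (Fin (n + 1))) (f (ψ v)) + η := by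
      have := abs_le.1 (hfD p (ψ v)); linarith [this.1]
    have h2 : angle (f p : EuclideanSpace ℝ (Fin (n + 1))) (f (ψ v)) ≤ ‖v‖ + η := by
      calc angle (f p : EuclideanSpace ℝ (Fin (n + 1))) (f (ψ v))
          ≤ angle (f p : EuclideanSpace ℝ (Fin (n + 1))) (Φ v) +
              angle (Φ v : EuclideanSpace ℝ (Fin (n + 1))) (f (ψ v)) := angle_le_angle_add_angle _ _ _
        _ ≤ ‖v‖ + η := by rw [← hy, hrad v hvπ]; linarith [hψ' v]
    show D p (ψ v) < (1 + δ) * σ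
    nlinarith
  · -- distortion
    have h1 := hfD (ψ v) (ψ w)
    have h2 := hA4 (f (ψ v) : EuclideanSpace ℝ (Fin (n + 1))) (Φ v) (f (ψ w)) (Φ w)
    have h3 := hdist v w (by linarith) (by linarith)
    have h4 : angle (f (ψ v) : EuclideanSpace ℝ (Fin (n + 1))) (Φ v) ≤ η := hψ v
    have h5 : angle (f (ψ w) : EuclideanSpace ℝ (Fin (n + 1))) (Φ w) ≤ η := hψ w
    show |D (ψ v) (ψ w) - ‖v - w‖| ≤ δ * σ
    rw [abs_le] at h1 h2 h3 ⊢
    constructor <;> nlinarith [h1.1, h1.2, h2.1, h2.2, h3.1, h3.2]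
  · -- density in `B_σ(p)`
    have ha' : D p a < σ := ha
    have h1 : angle (y : EuclideanSpace ℝ (Fin (n + 1))) (f a) < σ + η := by
      have := abs_le.1 (hfD p a); rw [hy]; linarith [this.2]
    obtain ⟨a', ha's, hΦa'⟩ := honto (f a) h1
    set μ : ℝ := σ / (σ + η) with hμ
    have hμ0 : 0 < μ := div_pos hσ0 hs0
    have hμ1 : μ ≤ 1 := (div_le_one hs0).2 (by linarith)
    set v : EuclideanSpace ℝ (Fin n) := μ • a' with hv
    have hnv : ‖v‖ = μ * ‖a'‖ := by rw [hv, norm_smul, Real.norm_eq_abs, abs_of_pos hμ0]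
    have hvσ : ‖v‖ < σ := by
      rw [hnv]
      by_cases ha0 : ‖a'‖ = 0
      · rw [ha0, mul_zero]; exact hσ0
      · calc μ * ‖a'‖ < μ * (σ + η) := mul_lt_mul_of_pos_left ha's hμ0
          _ = σ := by rw [hμ]; field_simp
    have hva' : ‖v - a'‖ ≤ η := by
      have e : v - a' = (μ - 1) • a' := by rw [hv, sub_smul, one_smul]
      rw [e, norm_smul, Real.norm_eq_abs, abs_of_nonpos (by linarith), neg_sub]
      have e2 : 1 - μ = η / (σ + η) := by rw [hμ]; field_simp; ring
      rw [e2, div_mul_eq_mul_div, div_le_iff₀ hs0]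
      nlinarith [norm_nonneg a']
    refine ⟨v, hvσ, ?_⟩
    have h2 := hfD (ψ v) a
    have h3 : angle (f (ψ v) : EuclideanSpace ℝ (Fin (n + 1))) (f a) ≤
        angle (f (ψ v) : EuclideanSpace ℝ (Fin (n + 1))) (Φ v) +
          angle (Φ v : EuclideanSpace ℝ (Fin (n + 1))) (Φ a') := by
      rw [← hΦa']; exact angle_le_angle_add_angle _ _ _
    have h4 : angle (f (ψ v) : EuclideanSpace ℝ (Fin (n + 1))) (Φ v) ≤ η := hψ v
    have h5 := hdist v a' (by linarith) ha's.le
    show D (ψ v) a ≤ δ * σ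
    rw [abs_le] at h2 h5
    nlinarith [h2.1, h2.2, h5.1, h5.2]

end Chart


/-! ### §3. The reduction: A.1.3 (at `Sⁿ`) and A.1.5 (iii) imply Thm. A.1.12 at `Sⁿ` -/

section Reduction

open Lorentzian (PseudoRiemannianMetric)

/-- **Cheeger–Colding 1997, Thm. A.1.12 at `Sⁿ` from Thm. A.1.3 and Thm. A.1.5 (iii)** — the
printed proof "By combining Theorems A.1.1 and A.1.5" (p. 458), PROVED as a reduction.

Hypothesis `hA13` is the INTRINSIC REIFENBERG THEOREM A.1.3 (p. 457; proof = proof of Thm. A.1.2,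
pp. 459–468) in the smooth compact case with `Z₂ = Sⁿ` (which lies in `𝓜(n, ε₁, r)` for
`r ≤ r₀(n)`, `roundSphere_reifenbergFlat`), in scale-invariant form: there are `ε₁(n), r₀(n) > 0`
such that for `0 < r ≤ r₀`, a compact connected Riemannian `n`-manifold all of whose points are
`(ε₁, r)`-Reifenberg (in `(Rⁿ)_{ε₁ r}`: an `ε₁ s`-chart `IsEuclideanBallGHChart` at every scale
`s ≤ u` for some `u > r`, as printed before Thm. A.1.1) and which is
`ε₁ r`-Gromov–Hausdorff close to `Sⁿ` (`IsRoundSphereGHApprox`) is diffeomorphic to `Sⁿ`.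
Hypothesis `hA15` is COLDING'S THEOREM A.1.5 (iii) (p. 458; [26] = Colding, Ann. of Math. 145
(1997)) for compact manifolds: for `ε > 0` there are `r(n, ε), δ(n, ε) > 0` such that if
`Ric ≥ -(n-1)`, `r₁ ≤ r` and `p` is `δ`-weakly regular at scale `r₁` (a `δ s`-chart of `B_s(p)`
for some `s > r₁`), then every `q` is `(ε, s)`-Reifenberg for `0 < s ≤ (1 - ε) r₁ - d(q, p)`.
Conclusion: `CheegerColding1997_sphereStability`. Proof: see the module docstring (constants
`ε = min(ε₁, 1/2)`, `δ' = min(δ, 1)`, `σ = min(1/2, r, δ'/16)`, `r₁ = σ/2`,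
`r' = min(r₀, (1 - ε) r₁ / 2)`, `ε(n) = min(δ' σ/8, ε₁ r')`).
[cite: CheegerColding1997, App. 1, Thms. A.1.3, A.1.5 (iii), A.1.12 and p. 458] -/
theorem CheegerColding1997_sphereStability_of_reifenberg_of_weaklyRegular
    (hA13 : ∀ n : ℕ, 2 ≤ n → ∃ ε₁ : ℝ, 0 < ε₁ ∧ ∃ r₀ : ℝ, 0 < r₀ ∧ ∀ r : ℝ, 0 < r → r ≤ r₀ →
      ∀ (M : Type) [TopologicalSpace M] [T2Space M] [SecondCountableTopology M]
        [ChartedSpace (EuclideanSpace ℝ (Fin n)) M] [IsManifold (𝓡 n) ∞ M] [CompactSpace M]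
        [ConnectedSpace M]
        (h : ContMDiffRiemannianMetric (𝓡 n) ∞ (EuclideanSpace ℝ (Fin n))
          (TangentSpace (𝓡 n) : M → Type _)),
        (∀ p : M, ∃ u : ℝ, r < u ∧ ∀ s : ℝ, 0 < s → s ≤ u →
            ∃ ψ : EuclideanSpace ℝ (Fin n) → M, IsEuclideanBallGHChart h p s ε₁ ψ) →
          (∃ f : M → Metric.sphere (0 : EuclideanSpace ℝ (Fin (n + 1))) 1,
              IsRoundSphereGHApprox n h (ε₁ * r) f) →
            Nonempty (M ≃ₘ⟮𝓡 n, 𝓡 n⟯ Metric.sphere (0 : EuclideanSpace ℝ (Fin (n + 1))) 1))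
    (hA15 : ∀ n : ℕ, 2 ≤ n → ∀ ε : ℝ, 0 < ε → ∃ r : ℝ, 0 < r ∧ ∃ δ : ℝ, 0 < δ ∧
      ∀ (M : Type) [TopologicalSpace M] [T2Space M] [SecondCountableTopology M]
        [ChartedSpace (EuclideanSpace ℝ (Fin n)) M] [IsManifold (𝓡 n) ∞ M] [CompactSpace M]
        [ConnectedSpace M] [MeasurableSpace M] [BorelSpace M]
        (h : ContMDiffRiemannianMetric (𝓡 n) ∞ (EuclideanSpace ℝ (Fin n))
          (TangentSpace (𝓡 n) : M → Type _))
        [(PseudoRiemannianMetric.ofRiemannian h).HasLeviCivita],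
        (∀ (x : M) (v : TangentSpace (𝓡 n) x),
            -((n : ℝ) - 1) * h.inner x v v ≤ (PseudoRiemannianMetric.ofRiemannian h).ricci x v v) →
          ∀ (p : M) (r₁ : ℝ), 0 < r₁ → r₁ ≤ r →
            (∃ s : ℝ, r₁ < s ∧ ∃ ψ : EuclideanSpace ℝ (Fin n) → M, IsEuclideanBallGHChart h p s δ ψ) →
              ∀ (q : M) (s : ℝ), 0 < s → s ≤ (1 - ε) * r₁ - riemannianDistOf h q p →
                ∃ ψ : EuclideanSpace ℝ (Fin n) → M, IsEuclideanBallGHChart h q s ε ψ) :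
    CheegerColding1997_sphereStability := by
  intro n hn
  have hn1 : 1 ≤ n := by omega
  -- constants depending on `n` only
  obtain ⟨ε₁, hε₁, r₀, hr₀, h13⟩ := hA13 n hn
  set ε : ℝ := min ε₁ (1 / 2) with hε
  have hε0 : 0 < ε := lt_min hε₁ (by norm_num)
  have hεε₁ : ε ≤ ε₁ := min_le_left _ _
  have hε12 : ε ≤ 1 / 2 := min_le_right _ _
  obtain ⟨r, hr, δ, hδ, h15⟩ := hA15 n hn ε hε0
  set δ' : ℝ := min δ 1 with hδ'
  have hδ'0 : 0 < δ' := lt_min hδ one_pos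
  have hδ'δ : δ' ≤ δ := min_le_left _ _
  have hδ'1 : δ' ≤ 1 := min_le_right _ _
  set σ : ℝ := min (1 / 2) (min r (δ' / 16)) with hσ
  have hσ0 : 0 < σ := lt_min (by norm_num) (lt_min hr (by positivity))
  have hσ12 : σ ≤ 1 / 2 := min_le_left _ _
  have hσr : σ ≤ r := (min_le_right _ _).trans (min_le_left _ _)
  have hσδ : 16 * σ ≤ δ' := by
    have : σ ≤ δ' / 16 := (min_le_right _ _).trans (min_le_right _ _)
    linarith
  set r₁ : ℝ := σ / 2 with hr₁
  have hr₁0 : 0 < r₁ := by positivity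
  have hr₁r : r₁ ≤ r := by rw [hr₁]; linarith
  set r' : ℝ := min r₀ ((1 - ε) * r₁ / 2) with hr'
  have h1ε : 0 < (1 - ε) * r₁ := mul_pos (by linarith) hr₁0
  have hr'0 : 0 < r' := lt_min hr₀ (by positivity)
  have hr'r₀ : r' ≤ r₀ := min_le_left _ _
  have hr'r₁ : r' < (1 - ε) * r₁ := (min_le_right _ _).trans_lt (by linarith)
  set ε₀ : ℝ := min (δ' * σ / 8) (ε₁ * r') with hε₀
  have hε₀0 : 0 < ε₀ := lt_min (by positivity) (mul_pos hε₁ hr'0)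
  refine ⟨ε₀, hε₀0, ?_⟩
  intro M _ _ _ _ _ _ _ _ _ h _ hRic hGH
  obtain ⟨f, hf⟩ := hGH
  -- Step A: every point is `δ'`-weakly regular at scale `r₁` (witnessing scale `σ = 2 r₁`)
  have hA : ∀ p : M, ∃ ψ : EuclideanSpace ℝ (Fin n) → M, IsEuclideanBallGHChart h p σ δ ψ := by
    intro p
    obtain ⟨ψ, hψ⟩ := exists_isEuclideanBallGHChart_of_isRoundSphereGHApprox (h := h) hn1 hf hσ0
      hσ12 hδ'1 hσδ (min_le_left _ _) p
    exact ⟨ψ, hψ.mono hσ0.le hδ'δ⟩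
  -- Step B: A.1.5 (iii) at `q = p`: every point is `(ε, (1-ε) r₁)`-Reifenberg
  have hB : ∀ (q : M) (s : ℝ), 0 < s → s ≤ (1 - ε) * r₁ →
      ∃ ψ : EuclideanSpace ℝ (Fin n) → M, IsEuclideanBallGHChart h q s ε₁ ψ := by
    intro q s hs0 hs
    have hWR : ∃ s : ℝ, r₁ < s ∧ ∃ ψ : EuclideanSpace ℝ (Fin n) → M,
        IsEuclideanBallGHChart h q s δ ψ := ⟨σ, by rw [hr₁]; linarith, hA q⟩
    have hs' : s ≤ (1 - ε) * r₁ - riemannianDistOf h q q := by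
      rw [riemannianDistOf_self, sub_zero]; exact hs
    obtain ⟨ψ, hψ⟩ := h15 M h hRic q r₁ hr₁0 hr₁r hWR q s hs0 hs'
    exact ⟨ψ, hψ.mono hs0.le hεε₁⟩
  -- Step C: the intrinsic Reifenberg theorem at scale `r'`
  refine h13 r' hr'0 hr'r₀ M h (fun p ↦ ⟨(1 - ε) * r₁, hr'r₁, fun s hs0 hs ↦ hB p s hs0 hs⟩)
    ⟨f, hf.mono ?_⟩
  exact min_le_right _ _

end Reduction

end Literature.Geometry.Riemannian

end
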